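/-
Copyright (c) 2026 the pub-hodgecm-mathlib formalisation cell (harness21).  Prover seat hodgecm-mathlib-B-p14 (g31) (Layer B′ design pen), (F11-c) brick (d1) «THE κ = −1 NORMAL
FORM»: transport of a type-(2) element with anisotropic complementary plane into `Stab(w₀)` (architect A-p06 (g26); LEAD F0P3a-plan (g9) T8-104 (4)), 2026-09-01.
-/
import Literature.NumberTheory.Automorphic.UnitaryThreeDoubleCosetsAnisotropic      -- ★ p841283 (F1′): Witt engine (F1′-W), `torusDiag`, `B₀_anisoVec`, `B₀_mulVec_mulVec_of_mem`
import Literature.NumberTheory.LocalFields.UnramifiedQuadraticNormSurjective         -- ★ `exists_mul_map_eq_of_finite_residueField` («`U_F = N U_E`»)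
import HarnessLib

/-!
# The κ = −1 normal form: an element of `U(2,1)(K)` with an eigenvector of ODD norm valuation is, up to `U`-conjugacy and a central unit, in `Stab(w₀)`
# (Flicker 1998, Prop. 4 pp. 80–82, Prop. 5 p. 82 «`t′ ∈ gH′g⁻¹ = Stab(ν₀)`», Prop. 16 p. 96)

Topic `NumberTheory/Automorphic`; namespace `Literature.NumberTheory.Automorphic.UnitaryGroup`.  THEOREMS ONLY (no `def`, no instance, no notation, no named fact,
no `sorry`; count-neutral).  Cell `pub/hodgecm-mathlib`, crux H413 = `stmt-HodgeConjecture-24833`, road «N7-ns COUNT FROM FLICKER» (architect A-p06 (g26)), line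
«N7nsCount», value stub `stub_irredGValueNeg` (κ = −1): the TRANSPORT feeding ★ (F2′) `natCard_fixedPoints_unitaryInt_eq_finsum_flickerDiag` and LAYER B′ (which
count the fixed points of an element OF `S = Stab(w₀)`, `w₀ = ![1, 0, −2ϖ]`, `B₀ w₀ w₀ = −4ϖ`).

THE MATHEMATICS.  `U = U(σ, Φ₃)(K)`, `K₀ = U ∩ GL₃(𝒪)`.  A type-(2) element `t` (irreducible `2 × 2` block) has exactly one eigenline `Kx` over `K`, `t x = u x`; its
orthogonal complement is the plane carrying the irreducible block, and it is ANISOTROPIC iff `ord B₀(x, x)` is odd (the κ = −1 class, ★ `finKappaAt_conj_eq_iff_corner_norm`: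
the corner is a norm iff κ = +1).  Then: (§2) `−4ϖ ∕ B₀(x,x)` is `σ`-fixed of EVEN valuation, hence a norm `λ σλ` (units of `F` are norms from the unramified `E`,
★ `exists_mul_map_eq_of_finite_residueField`, times `ϖ^k σ(ϖ^k) = ϖ^{2k}`), so `x′ = λx` has `B₀(x′,x′) = −4ϖ = B₀(w₀,w₀)`; (§1, WITT for `w₀`) some `g ∈ U` has
`g w₀ = x′` (the engine of ★ (A′): sup-norm scaling, ★ (F1′-W) `exists_mem_unitaryInt_mulVec_normalForm_eq`, the torus `diag(α, 1, (σα)⁻¹)`); (§3) `u σu = 1`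
(`B₀(tx,tx) = B₀(x,x) ≠ 0`) so `z = u·1 ∈ U ∩ K₀` is central; (§4) **`t′ := z⁻¹ (g⁻¹ t g) ∈ Stab(w₀)`** (`(g⁻¹tg) w₀ = g⁻¹ t x′ = u w₀`).  The sequel (d2) transports
the fixed-point count on `U ⧸ K₀` (invariant under conjugation and central `K₀`-translation) and the exponent data (`charpoly`) along `t ↦ t′`.
HONEST LABEL: HC_CM is proved only modulo the printed citations until rung 0 closes; structure theory feeding ONE value stub of #103-ns, pays nothing by itself.

## References
* [Flicker1998UnitaryFL] Y. Z. Flicker, *Elementary proof of the fundamental lemma for a unitary group*, Canad. J. Math. 50 (1998), Prop. 4 pp. 80–82, Prop. 5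
  p. 82, Prop. 16 p. 96.
* [Serre1979] J.-P. Serre, *Local Fields*, GTM 67 (1979), Ch. V §2 Prop. 3 and Corollary (units are norms in the unramified case).
* [Omeara1963] O. T. O'Meara, *Introduction to Quadratic Forms* (1963), §82F.
-/

set_option autoImplicit false

noncomputable section

open scoped MatrixGroups WithZero Valued
open Matrix

namespace Literature.NumberTheory.Automorphic

namespace UnitaryGroup

open Literature.NumberTheory.Automorphic.HermitianLattice
open Literature.NumberTheory.LocalFields.UnramifiedQuadraticNorm (exists_mul_map_eq_of_finite_residueField)

variable {K : Type*} [Field K] [Valued K ℤᵐ⁰] {ϖ : K}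
  (σ : K →+* K) {J : Matrix (Fin 3) (Fin 3) K} (hJ : J = (StdForm.antidiagonal 3).over K)

/-! ## §1 Witt's theorem for the anisotropic vector `w₀`: `U` is transitive on `{w : B₀(w,w) = −4ϖ}` -/

include hJ in
/-- **WITT FOR `w₀`**: every `w ∈ K³` with `B₀(w, w) = −4ϖ = B₀(w₀, w₀)` is `g · w₀` for some `g ∈ U(σ, Φ₃)` — the engine of ★ (A′) `exists_stabilizer_mul_flickerDiag_mul_unitaryInt`
(sup-norm scaling `v = α⁻¹w ∈ 𝒪³` primitive, `B₀(v,v) = a`, `|a| < 1`; ★ (F1′-W) `k₁ · (e₀ + (a∕2)e₂) = v`, `k₁ ∈ K₀`; the torus `diag(α, 1, (σα)⁻¹) · w₀ = α(e₀ + (a∕2)e₂)`).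
[cite: Flicker1998UnitaryFL, Prop. 4 pp. 80–82] [cite: Omeara1963, §82F] -/
theorem exists_mulVec_anisoVec_eq (hd : LocalConjDatum σ ϖ) {w : Fin 3 → K} (hBww : B₀ σ 3 w w = -(4 * ϖ)) :
    ∃ g : ↥(unitaryGroupOfForm σ J), ((g : GL (Fin 3) K) : Matrix (Fin 3) (Fin 3) K) *ᵥ ![1, 0, -(2 * ϖ)] = w := by
  have hσ := hd.σσ
  have hvσ := hd.vσ
  have hϖ0 : ϖ ≠ 0 := hd.ϖ_ne_zero
  have h20 : (2 : K) ≠ 0 := fun h0 => by have := hd.v2; rw [h0, map_zero] at this; exact zero_ne_one this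
  have h40 : (4 : K) * ϖ ≠ 0 := mul_ne_zero (by rw [show (4 : K) = 2 * 2 by norm_num]; exact mul_ne_zero h20 h20) hϖ0
  set w₀ : Fin 3 → K := ![1, 0, -(2 * ϖ)] with hw₀
  have hw0 : w ≠ 0 := by
    intro h0
    rw [h0] at hBww
    simp only [map_zero] at hBww
    exact h40 (neg_eq_zero.1 hBww.symm)
  -- normalise by the largest coordinate
  obtain ⟨j, hj0, hvL, hvj⟩ := exists_inv_smul_mem_stdLattice hw0
  set α : K := w j with hαdef
  have hσα0 : σ α ≠ 0 := (map_ne_zero σ).2 hj0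
  set v : Fin 3 → K := α⁻¹ • w with hvdef
  set a : K := -(4 * ϖ) * ((σ α)⁻¹ * α⁻¹) with hadef
  have hσa : σ a = a := by
    rw [hadef, map_mul, map_neg, map_mul, map_ofNat, hd.σϖ, map_mul, map_inv₀, map_inv₀, hσ]; ring
  have hvv : B₀ σ 3 v v = a := by
    rw [hvdef]
    simp only [map_smulₛₗ, LinearMap.smul_apply, smul_eq_mul, RingHom.id_apply, hBww, map_inv₀]
    rw [hadef]; ring
  -- `|a| ≤ 1` and, by parity of the valuation, `|a| < 1`
  have ha1 : Valued.v a ≤ 1 := by rw [← hvv]; exact v_B₀_le_one hvσ hvL hvL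
  have hvα0 : Valued.v α ≠ 0 := (Valuation.ne_zero_iff _).2 hj0
  obtain ⟨la, hla⟩ : ∃ la : ℤ, Valued.v α = WithZero.exp la := ⟨_, (WithZero.exp_log hvα0).symm⟩
  have hva : Valued.v a = WithZero.exp (-1 - 2 * la) := by
    rw [hadef, map_mul, Valuation.map_neg, map_mul, map_mul, map_inv₀, map_inv₀, hvσ,
      show (4 : K) = 2 * 2 by norm_num, map_mul, hd.v2, one_mul, one_mul, hd.vϖ, hla, ← WithZero.exp_neg, ← WithZero.exp_add, ← WithZero.exp_add]
    congr 1; ring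
  have halt : Valued.v a < 1 := by
    rw [hva, ← WithZero.exp_zero, WithZero.exp_lt_exp]
    rw [hva, ← WithZero.exp_zero, WithZero.exp_le_exp] at ha1
    omega
  -- a unit coordinate off the `rev`-fixed index, and the transitivity engine (F1′-W)
  obtain ⟨j', hj', hj'u⟩ := exists_rev_ne_v_eq_one_of_v_B₀_lt_one hvσ hvL ⟨j, by rw [hvj, map_one]⟩ (hvv ▸ halt)
  obtain ⟨k₁, -, hk₁v⟩ := exists_mem_unitaryInt_mulVec_normalForm_eq (N := 3) hσ hvσ hd.v2 hσa ha1 hvL hj' hj'u hvv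
    (i₀ := 0) (by decide)
  -- the torus element `t = diag(α, 1, (σα)⁻¹)`: `t w₀ = α · (e₀ + (a∕2) e₂)`
  obtain ⟨t, ht⟩ := exists_coe_eq_torusDiag σ hJ hσ hj0
  have htw : ((t : GL (Fin 3) K) : Matrix (Fin 3) (Fin 3) K) *ᵥ w₀ = α • (Pi.single 0 1 + (a / 2) • Pi.single (Fin.rev 0) 1) := by
    rw [ht, hw₀, torusDiag_mulVec_anisoVec σ h20 hj0 hσα0 ϖ]
  have hk₁J : ((k₁ : GL (Fin 3) K)) ∈ unitaryGroupOfForm σ J := by rw [hJ]; exact k₁.2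
  set k₁' : ↥(unitaryGroupOfForm σ J) := ⟨(k₁ : GL (Fin 3) K), hk₁J⟩ with hk₁'
  refine ⟨k₁' * t, ?_⟩
  rw [Subgroup.coe_mul, Units.val_mul, ← Matrix.mulVec_mulVec, htw, Matrix.mulVec_smul,
    show (((k₁' : GL (Fin 3) K) : Matrix (Fin 3) (Fin 3) K)) = ((k₁ : GL (Fin 3) K) : Matrix (Fin 3) (Fin 3) K) from rfl,
    hk₁v, hvdef, smul_smul, mul_inv_cancel₀ hj0, one_smul]

/-! ## §2 A `σ`-fixed element of EVEN valuation is a norm (units of `F` are norms from the unramified `E`, and `ϖ^{2k} = ϖ^k·σ(ϖ^k)`) -/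

/-- **Norms of even valuation**: `σ c = c`, `|c| = |ϖ|^{−2k}·` i.e. `v c = exp(2k)` (`k ∈ ℤ`) ⇒ `c = λ·σλ` for some `λ ∈ K` — the unit `c·ϖ^{2k}` is a norm `s σs`,
`s ∈ 𝒪` (★ `exists_mul_map_eq_of_finite_residueField`, frame data `hσO ∕ ha₀` as in ★ FILE 2e-β), and `λ = s·ϖ^{−k}`.
[cite: Serre1979, Ch. V §2 Prop. 3 and Corollary] -/
theorem exists_mul_map_eq_of_v_eq_exp_even (hd : LocalConjDatum σ ϖ) (hσO : ∀ y : 𝒪[K], (σ.comp 𝒪[K].subtype) y ∈ 𝒪[K])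
    [IsDiscreteValuationRing 𝒪[K]] [Finite (IsLocalRing.ResidueField 𝒪[K])] [IsAdicComplete 𝓂[K] 𝒪[K]]
    {a₀ : 𝒪[K]} (ha₀ : IsUnit (((σ.comp 𝒪[K].subtype).codRestrict 𝒪[K] hσO) a₀ - a₀))
    {c : K} (hσc : σ c = c) {k : ℤ} (hc : Valued.v c = WithZero.exp (2 * k)) :
    ∃ lam : K, lam * σ lam = c := by
  have hσ := hd.σσ
  have hϖ0 : ϖ ≠ 0 := hd.ϖ_ne_zero
  set σO : 𝒪[K] →+* 𝒪[K] := (σ.comp 𝒪[K].subtype).codRestrict 𝒪[K] hσO with hσOdef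
  have hσOσ : ∀ y : 𝒪[K], σO (σO y) = y := fun y => Subtype.ext (hσ y)
  -- the unit `u = c · ϖ^{2k}`
  set u : K := c * ϖ ^ (2 * k) with hudef
  have hvu : Valued.v u = 1 := by
    rw [hudef, map_mul, map_zpow₀, hc, hd.vϖ, ← WithZero.exp_zsmul, smul_eq_mul, ← WithZero.exp_add, ← WithZero.exp_zero]
    congr 1; ring
  have hσu : σ u = u := by rw [hudef, map_mul, hσc, map_zpow₀, hd.σϖ]
  have huO : u ∈ 𝒪[K] := by
    change Valued.v u ≤ 1
    exact hvu.le
  have huunit : IsUnit (⟨u, huO⟩ : 𝒪[K]) :=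
    (Valuation.integer.integers (Valued.v (R := K))).isUnit_iff_valuation_eq_one.2 hvu
  have hσOu : σO ⟨u, huO⟩ = ⟨u, huO⟩ := Subtype.ext hσu
  obtain ⟨s, hs⟩ := exists_mul_map_eq_of_finite_residueField σO hσOσ ha₀ ⟨u, huO⟩ huunit hσOu
  have hs' : (s : K) * σ (s : K) = u := by
    have := congrArg Subtype.val hs
    simpa [hσOdef] using this
  refine ⟨(s : K) * (ϖ ^ k)⁻¹, ?_⟩
  have hϖk : σ (ϖ ^ k) = ϖ ^ k := by rw [map_zpow₀, hd.σϖ]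
  rw [map_mul, map_inv₀, hϖk, show (s : K) * (ϖ ^ k)⁻¹ * (σ (s : K) * (ϖ ^ k)⁻¹) = ((s : K) * σ (s : K)) * ((ϖ ^ k)⁻¹ * (ϖ ^ k)⁻¹) by ring,
    hs', hudef, ← mul_inv, ← zpow_add₀ hϖ0, show k + k = 2 * k by ring, mul_assoc, mul_inv_cancel₀ (zpow_ne_zero _ hϖ0), mul_one]

/-! ## §3 The eigenvalue on an anisotropic eigenvector is of norm one; the central element `u·1 ∈ U ∩ K₀` -/

omit [Valued K ℤᵐ⁰] in
include hJ in
/-- If `t ∈ U` has `t x = u x` with `B₀(x, x) ≠ 0` then `σ u · u = 1` (`B₀(tx, tx) = σu·u·B₀(x,x)`). [cite: Flicker1998UnitaryFL, Prop. 16 p. 96 (`t′ ∈ Stab(ν₀)` up to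
the centre)] -/
theorem map_mul_self_eq_one_of_mulVec_eq_smul (t : ↥(unitaryGroupOfForm σ J)) {x : Fin 3 → K} {u : K}
    (htx : ((t : GL (Fin 3) K) : Matrix (Fin 3) (Fin 3) K) *ᵥ x = u • x) (hx : B₀ σ 3 x x ≠ 0) : σ u * u = 1 := by
  have h := B₀_mulVec_mulVec_of_mem σ hJ t x x
  rw [htx] at h
  simp only [map_smulₛₗ, LinearMap.smul_apply, smul_eq_mul, RingHom.id_apply] at h
  have h' : (σ u * u) * B₀ σ 3 x x = 1 * B₀ σ 3 x x := by linear_combination h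
  exact mul_right_cancel₀ hx h'

include hJ in
/-- **The scalar `u·1` lies in `U(σ, Φ₃)` when `σu·u = 1`, in `K₀` (then `|u| = 1`), and is central.** [cite: Flicker1998UnitaryFL, Prop. 16 p. 96] -/
theorem exists_coe_eq_smul_one (hd : LocalConjDatum σ ϖ) {u : K} (hu : σ u * u = 1) :
    ∃ z : ↥(unitaryGroupOfForm σ J), ((z : GL (Fin 3) K) : Matrix (Fin 3) (Fin 3) K) = u • (1 : Matrix (Fin 3) (Fin 3) K) ∧
      z ∈ unitaryInt σ J ∧ ∀ y : ↥(unitaryGroupOfForm σ J), z * y = y * z := by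
  have hu0 : u ≠ 0 := fun h0 => by rw [h0, mul_zero] at hu; exact zero_ne_one hu
  have hdet : (u • (1 : Matrix (Fin 3) (Fin 3) K)).det ≠ 0 := by
    rw [Matrix.det_smul, Matrix.det_one, mul_one, Fintype.card_fin]; exact pow_ne_zero _ hu0
  set Z : GL (Fin 3) K := Matrix.GeneralLinearGroup.mkOfDetNeZero _ hdet with hZ
  have hZval : (Z : Matrix (Fin 3) (Fin 3) K) = u • 1 := Matrix.GeneralLinearGroup.val_mkOfDetNeZero _ _
  have hmem : Z ∈ unitaryGroupOfForm σ J := by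
    rw [hJ, mem_unitaryGroupOfForm_antidiagonal_iff]
    intro x y
    rw [hZval, Matrix.smul_mulVec, Matrix.one_mulVec, Matrix.smul_mulVec, Matrix.one_mulVec]
    simp only [map_smulₛₗ, LinearMap.smul_apply, smul_eq_mul, RingHom.id_apply]
    linear_combination (B₀ σ 3 x y) * hu
  have hvu : Valued.v u = 1 := by
    have h := congrArg Valued.v hu
    rw [map_mul, hd.vσ, map_one, ← pow_two] at h
    exact (pow_eq_one_iff.1 h).resolve_right (by norm_num)
  refine ⟨⟨Z, hmem⟩, hZval, ?_, fun y => ?_⟩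
  · rw [mem_unitaryInt_iff_forall_v_apply_le_one σ hJ hd.vσ]
    intro i l
    rw [show (((⟨Z, hmem⟩ : ↥(unitaryGroupOfForm σ J)) : GL (Fin 3) K) : Matrix (Fin 3) (Fin 3) K) = u • 1 from hZval, Matrix.smul_apply,
      Matrix.one_apply, smul_eq_mul]
    split_ifs
    · rw [mul_one, hvu]
    · rw [mul_zero, map_zero]; exact zero_le_one
  · apply Subtype.ext; apply Units.ext
    rw [Subgroup.coe_mul, Subgroup.coe_mul, Units.val_mul, Units.val_mul,
      show (((⟨Z, hmem⟩ : ↥(unitaryGroupOfForm σ J)) : GL (Fin 3) K) : Matrix (Fin 3) (Fin 3) K) = u • 1 from hZval, Matrix.smul_mul, Matrix.mul_smul,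
      Matrix.one_mul, Matrix.mul_one]

/-! ## §4 The normal form -/

include hJ in
/-- **THE κ = −1 NORMAL FORM.**  Let `t ∈ U(σ, Φ₃)(K)` have an eigenvector `x`, `t x = u x`, of ODD norm valuation `v(B₀(x,x)) = exp(2k+1)` (its orthogonal plane is anisotropic).
Then there are `g ∈ U` and the central `z = u·1 ∈ U ∩ K₀` with **`z⁻¹ · (g⁻¹ t g) ∈ Stab(w₀)`**, `w₀ = ![1, 0, −2ϖ]` — Flicker's «`t′` lies in `gH′g⁻¹ = Stab(ν₀)`» for the
anisotropic torus, made central-free.  (`x′ = λx` with `B₀(x′,x′) = −4ϖ` by §2; `g w₀ = x′` by §1; `(g⁻¹tg) w₀ = u w₀`.) [cite: Flicker1998UnitaryFL, Prop. 5 p. 82; Prop. 16 p. 96] -/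
theorem exists_smul_one_inv_mul_conj_mem_stabilizer (hd : LocalConjDatum σ ϖ) (hσO : ∀ y : 𝒪[K], (σ.comp 𝒪[K].subtype) y ∈ 𝒪[K])
    [IsDiscreteValuationRing 𝒪[K]] [Finite (IsLocalRing.ResidueField 𝒪[K])] [IsAdicComplete 𝓂[K] 𝒪[K]]
    {a₀ : 𝒪[K]} (ha₀ : IsUnit (((σ.comp 𝒪[K].subtype).codRestrict 𝒪[K] hσO) a₀ - a₀))
    {t : ↥(unitaryGroupOfForm σ J)} {x : Fin 3 → K} {u : K} (htx : ((t : GL (Fin 3) K) : Matrix (Fin 3) (Fin 3) K) *ᵥ x = u • x)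
    {k : ℤ} (hx : Valued.v (B₀ σ 3 x x) = WithZero.exp (2 * k + 1)) :
    ∃ g z : ↥(unitaryGroupOfForm σ J), ((z : GL (Fin 3) K) : Matrix (Fin 3) (Fin 3) K) = u • (1 : Matrix (Fin 3) (Fin 3) K) ∧
      z ∈ unitaryInt σ J ∧ (∀ y : ↥(unitaryGroupOfForm σ J), z * y = y * z) ∧
      ((g : GL (Fin 3) K) : Matrix (Fin 3) (Fin 3) K) *ᵥ ![1, 0, -(2 * ϖ)] ∈ (K ∙ x) ∧
      z⁻¹ * (g⁻¹ * t * g) ∈ MulAction.stabilizer (↥(unitaryGroupOfForm σ J)) (![1, 0, -(2 * ϖ)] : Fin 3 → K) := by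
  have hσ := hd.σσ
  have hϖ0 : ϖ ≠ 0 := hd.ϖ_ne_zero
  have h20 : (2 : K) ≠ 0 := fun h0 => by have := hd.v2; rw [h0, map_zero] at this; exact zero_ne_one this
  have h40 : (4 : K) * ϖ ≠ 0 := mul_ne_zero (by rw [show (4 : K) = 2 * 2 by norm_num]; exact mul_ne_zero h20 h20) hϖ0
  have hBx0 : B₀ σ 3 x x ≠ 0 := fun h0 => by rw [h0, map_zero] at hx; exact WithZero.coe_ne_zero hx.symm
  -- §2: rescale `x` to norm `−4ϖ`
  set c : K := -(4 * ϖ) / B₀ σ 3 x x with hcdef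
  have hσB : σ (B₀ σ 3 x x) = B₀ σ 3 x x := isHermitianForm_B₀ hσ x x
  have hσc : σ c = c := by rw [hcdef, map_div₀, map_neg, map_mul, map_ofNat, hd.σϖ, hσB]
  have hvc : Valued.v c = WithZero.exp (2 * (-(k + 1))) := by
    rw [hcdef, map_div₀, Valuation.map_neg, map_mul, show (4 : K) = 2 * 2 by norm_num, map_mul, hd.v2, one_mul, one_mul, hd.vϖ, hx,
      ← WithZero.exp_sub]
    congr 1; ring
  obtain ⟨lam, hlam⟩ := exists_mul_map_eq_of_v_eq_exp_even σ hd hσO ha₀ hσc hvc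
  set x' : Fin 3 → K := lam • x with hx'def
  have hBx' : B₀ σ 3 x' x' = -(4 * ϖ) := by
    have key : lam * σ lam * B₀ σ 3 x x = -(4 * ϖ) := by rw [hlam, hcdef, div_mul_cancel₀ _ hBx0]
    rw [hx'def]
    simp only [map_smulₛₗ, LinearMap.smul_apply, smul_eq_mul, RingHom.id_apply]
    linear_combination key
  -- §1: `g w₀ = x′`
  obtain ⟨g, hg⟩ := exists_mulVec_anisoVec_eq σ hJ hd hBx'
  -- §3: `z = u·1`
  have hu : σ u * u = 1 := map_mul_self_eq_one_of_mulVec_eq_smul σ hJ t htx hBx0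
  obtain ⟨z, hz, hzK, hzc⟩ := exists_coe_eq_smul_one σ hJ hd hu
  have hu0 : u ≠ 0 := fun h0 => by rw [h0, mul_zero] at hu; exact zero_ne_one hu
  refine ⟨g, z, hz, hzK, hzc, ?_, ?_⟩
  · rw [hg, hx'def]; exact Submodule.smul_mem _ _ (Submodule.mem_span_singleton_self x)
  -- §4: `(z⁻¹ g⁻¹ t g) w₀ = w₀`
  rw [MulAction.mem_stabilizer_iff]
  change ((((z⁻¹ * (g⁻¹ * t * g) : ↥(unitaryGroupOfForm σ J))) : GL (Fin 3) K) : Matrix (Fin 3) (Fin 3) K) *ᵥ ![1, 0, -(2 * ϖ)] = ![1, 0, -(2 * ϖ)]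
  have hmat : ∀ a c : ↥(unitaryGroupOfForm σ J), (((a * c : ↥(unitaryGroupOfForm σ J)) : GL (Fin 3) K) : Matrix (Fin 3) (Fin 3) K) =
      ((a : GL (Fin 3) K) : Matrix (Fin 3) (Fin 3) K) * ((c : GL (Fin 3) K) : Matrix (Fin 3) (Fin 3) K) := fun a c => by
    rw [Subgroup.coe_mul, Units.val_mul]
  have hginv : (((g⁻¹ : ↥(unitaryGroupOfForm σ J)) : GL (Fin 3) K) : Matrix (Fin 3) (Fin 3) K) *ᵥ x' = ![1, 0, -(2 * ϖ)] := by
    have h1 : (((g⁻¹ * g : ↥(unitaryGroupOfForm σ J)) : GL (Fin 3) K) : Matrix (Fin 3) (Fin 3) K) = 1 := by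
      rw [inv_mul_cancel, Subgroup.coe_one, Units.val_one]
    have := congrArg (fun M : Matrix (Fin 3) (Fin 3) K => M *ᵥ (![1, 0, -(2 * ϖ)] : Fin 3 → K)) h1
    simp only [hmat, ← Matrix.mulVec_mulVec, hg, Matrix.one_mulVec] at this
    exact this
  have hzinv : (((z⁻¹ : ↥(unitaryGroupOfForm σ J)) : GL (Fin 3) K) : Matrix (Fin 3) (Fin 3) K) = u⁻¹ • (1 : Matrix (Fin 3) (Fin 3) K) := by
    rw [Subgroup.coe_inv, Matrix.coe_units_inv, hz]
    exact Matrix.inv_eq_left_inv (by rw [Matrix.smul_mul, Matrix.one_mul, smul_smul, inv_mul_cancel₀ hu0, one_smul])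
  have htx' : ((t : GL (Fin 3) K) : Matrix (Fin 3) (Fin 3) K) *ᵥ x' = u • x' := by
    rw [hx'def, Matrix.mulVec_smul, htx, smul_comm]
  rw [hmat, hmat, hmat, ← Matrix.mulVec_mulVec, ← Matrix.mulVec_mulVec, ← Matrix.mulVec_mulVec, hg, htx', Matrix.mulVec_smul, hginv, hzinv,
    Matrix.smul_mulVec, Matrix.one_mulVec, smul_smul, inv_mul_cancel₀ hu0, one_smul]

end UnitaryGroup

end Literature.NumberTheory.Automorphic

end
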